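import Summits.BirchSwinnertonDyer.BirchSwinnertonDyer.Theorems.Rank2ObservatoryTateStep2Cert
import Literature.NumberTheory.DiophantineGeometry.TateAlgorithmIstarEvalProofs
import Literature.NumberTheory.DiophantineGeometry.TateAlgorithmProofs
import Literature.NumberTheory.EllipticCurves.GlobalMinimalModelProofs
import Literature.NumberTheory.DiophantineGeometry.LocalReductionHasMultiplicativeReductionAtProofs
import HarnessLib

/-!
# Rank-2 observatory (b2b-bsdr2, cert-2 gen 7): Tate certificates for Steps 6–10 — part 1/3:
# integer coefficients read in a DVR, and the exits `I₀*` (Step 6), `IV*` (8), `III*` (9), `II*` (10)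

HONEST FRAMING: per-curve certified theorems and census instruments; no claim on BSD in rank ≥ 2.

Gen 6 (`Rank2ObservatoryTateStep2Cert`) certified the conductor exponent `f_p` of an integer model
for the exits of Steps 3–5 of Tate's algorithm [Silverman1994, IV.9.4] (types `II`, `III`, `IV`).
This three-part module does the same for the DEEP exits, Steps 6–10 — types `I₀*`, `Iₙ*`, `IV*`,
`III*`, `II*`, i.e. every remaining additive type — through the tree's own evaluation theorems of
the literal algorithm (`TateAlgorithmEval`, `TateAlgorithmIstarEval`), with no named fact:
* part 1 (this file): the DVR reading of integer divisibilities and the one-shot exits 6, 8, 9, 10;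
* part 2 (`Rank2ObservatoryTateDeepIstar`): the `Iₙ*` sub-procedure of Step 7 on ONE model, and
  the plumbing from the cast model in `O_v` to `kodairaSymbolAt v` / `ordMinimalDiscriminant v`;
* part 3 (`Rank2ObservatoryTateDeepCert`): the certificate `DeepCert`, its Boolean `check`,
  soundness, `conductorExponent = n + 1 − #components`, and kernel self-tests.

## Method

Over any DVR `R` with perfect residue field and a presentation `p = ϖ ε` (`ε ∈ Rˣ`), an integer
divisibility `pʲ ∣ a` becomes `ϖʲ ∣ a` for the cast, the reduced coefficient of `a` at order `j` is
`ε̄ʲ · (a/pʲ)‾` (`redCoeff_intCast`), and every exit test of the algorithm is a weighted-homogeneous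
form in reduced coefficients, so it equals `ε̄ᵏ ·` (integer test)‾ — non-zero iff `p ∤` the integer
test (`residue_intCast_ne_zero`: the residue field has characteristic `p`).  The four theorems
`kodairaSymbolOfMinimal_intCast_eq_{Istar_zero, IVstar, IIIstar, IIstar}` feed these facts to the
tree's `kodairaSymbolOfMinimal_eq_*_of_step{6,8,9}` with the user model equal to the cast model
(change of variables `C = 1`).

Engines (for the data this serves): engine 1 = `tate/tate_deep.py` (own Tate Steps 1–10 on integer
models), engine 2 = PARI `elllocalred`; the Lean kernel re-verifies every certificate by `decide`.
-/

open scoped NumberField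
open Polynomial IsLocalRing IsDedekindDomain Rat.HeightOneSpectrum WeierstrassCurve
  Literature.NumberTheory.EllipticCurves Literature.NumberTheory.GaloisRepresentations
  Literature.NumberTheory.DiophantineGeometry Literature.NumberTheory.DiophantineGeometry.TateAlgorithm

namespace Summit.BirchSwinnertonDyer.BirchSwinnertonDyer.Rank2Observatory.Tate

/-- The discriminant of the monic integer cubic `T³ + P T² + Q T + R` (Step 6 of Tate's algorithm
tests whether its reduction has three distinct roots). [cite: Silverman1994, IV.9.4 Step 6] -/
def disc3 (P Q R : ℤ) : ℤ :=
  P ^ 2 * Q ^ 2 - 4 * Q ^ 3 - 4 * P ^ 3 * R - 27 * R ^ 2 + 18 * P * Q * R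

/-! ### Integer coefficients read in a DVR `R` with `p = ϖ · ε`, `ε ∈ Rˣ` -/

section DVR

variable {R : Type*} [CommRing R] [IsDomain R] [IsDiscreteValuationRing R] {p : ℕ} {ε : R}

/-- If `pʲ ∣ a` in `ℤ` and `p = ϖ ε` in `R`, then `a = ϖʲ · (εʲ · (a / pʲ))` in `R`. [folklore] -/
theorem intCast_eq_of_pow_dvd (hpε : (p : R) = uniformizer R * ε) {a : ℤ} {j : ℕ}
    (h : (p : ℤ) ^ j ∣ a) :
    ((a : ℤ) : R) = uniformizer R ^ j * (ε ^ j * ((a / (p : ℤ) ^ j : ℤ) : R)) := by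
  conv_lhs => rw [← Int.mul_ediv_cancel' h]
  push_cast
  rw [hpε]; ring

/-- `pʲ ∣ a` in `ℤ` gives `ϖʲ ∣ a` in `R`. [folklore] -/
theorem uniformizer_pow_dvd_intCast (hpε : (p : R) = uniformizer R * ε) {a : ℤ} {j : ℕ}
    (h : (p : ℤ) ^ j ∣ a) : uniformizer R ^ j ∣ ((a : ℤ) : R) :=
  ⟨_, intCast_eq_of_pow_dvd hpε h⟩

/-- `p ∣ a` in `ℤ` gives `ϖ ∣ a` in `R`. [folklore] -/
theorem uniformizer_dvd_intCast (hpε : (p : R) = uniformizer R * ε) {a : ℤ}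
    (h : (p : ℤ) ^ 1 ∣ a) : uniformizer R ∣ ((a : ℤ) : R) := by
  simpa using uniformizer_pow_dvd_intCast hpε h

/-- The reduced coefficient `a_{·,j}` of an integer `a` with `pʲ ∣ a`: `ε̄ʲ · (a / pʲ)‾`. [folklore] -/
theorem redCoeff_intCast (hpε : (p : R) = uniformizer R * ε) {a : ℤ} {j : ℕ}
    (h : (p : ℤ) ^ j ∣ a) :
    redCoeff ((a : ℤ) : R) j = residue R ε ^ j * residue R ((a / (p : ℤ) ^ j : ℤ) : R) := by
  rw [intCast_eq_of_pow_dvd hpε h, redCoeff_uniformizer_pow_mul, map_mul, map_pow]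

/-- If `pʲ⁺¹ ∣ a` then `a_{·,j} = 0`. [folklore] -/
theorem redCoeff_intCast_eq_zero (hpε : (p : R) = uniformizer R * ε) {a : ℤ} {j : ℕ}
    (h : (p : ℤ) ^ (j + 1) ∣ a) : redCoeff ((a : ℤ) : R) j = 0 :=
  redCoeff_eq_zero_of_dvd (uniformizer_pow_dvd_intCast hpε h)

/-- The residue field of `R` has characteristic `p` when the prime `p` is `ϖ ε`. [folklore] -/
theorem charP_residueField (hp : p.Prime) (hpε : (p : R) = uniformizer R * ε) :
    CharP (ResidueField R) p := by
  rw [CharP.charP_iff_prime_eq_zero hp]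
  have : residue R (p : R) = 0 := by
    rw [hpε, map_mul, residue_uniformizer_eq_zero irreducible_uniformizer, zero_mul]
  simpa using this

/-- Integers prime to `p` have non-zero residue in `R`. [folklore] -/
theorem residue_intCast_ne_zero (hp : p.Prime) (hpε : (p : R) = uniformizer R * ε) {d : ℤ}
    (h : ¬ (p : ℤ) ∣ d) : residue R ((d : ℤ) : R) ≠ 0 := by
  haveI := charP_residueField hp hpε
  rw [map_intCast, Ne, CharP.intCast_eq_zero_iff (ResidueField R) p]
  exact h

/-- Integers prime to `p` are units of `R`. [folklore] -/
theorem isUnit_intCast (hp : p.Prime) (hpε : (p : R) = uniformizer R * ε) {d : ℤ}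
    (h : ¬ (p : ℤ) ∣ d) : IsUnit ((d : ℤ) : R) :=
  (isUnit_iff_residue_ne_zero _).mpr (residue_intCast_ne_zero hp hpε h)

/-- `pⁿ ∥ a` in `ℤ` implies `p ∤ a / pⁿ`. [folklore] -/
theorem not_dvd_div_of_pexact {a : ℤ} {n : ℕ} (h : (p : ℤ) ^ n ∣ a)
    (h' : ¬ (p : ℤ) ^ (n + 1) ∣ a) : ¬ (p : ℤ) ∣ a / (p : ℤ) ^ n := by
  intro hd
  refine h' ?_
  rw [← Int.mul_ediv_cancel' h, pow_succ]
  exact mul_dvd_mul_left _ hd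

/-- `pⁿ ∥ a` in `ℤ` gives `ord (a) = n` in `R`. [folklore] -/
theorem addVal_intCast_toNat_eq (hp : p.Prime) (hε : IsUnit ε)
    (hpε : (p : R) = uniformizer R * ε) {a : ℤ} {n : ℕ} (h : (p : ℤ) ^ n ∣ a)
    (h' : ¬ (p : ℤ) ^ (n + 1) ∣ a) :
    (IsDiscreteValuationRing.addVal R ((a : ℤ) : R)).toNat = n :=
  addVal_toNat_eq_of_eq irreducible_uniformizer isUnit_one
    ((hε.pow n).mul (isUnit_intCast hp hpε (not_dvd_div_of_pexact h h')))
    (by rw [one_mul, intCast_eq_of_pow_dvd hpε h])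

/-- `pⁿ ∥ a` in `ℤ` gives `ϖⁿ⁺¹ ∤ a` in `R`. [folklore] -/
theorem not_pow_succ_dvd_intCast (hp : p.Prime) (hε : IsUnit ε)
    (hpε : (p : R) = uniformizer R * ε) {a : ℤ} {n : ℕ} (h : (p : ℤ) ^ n ∣ a)
    (h' : ¬ (p : ℤ) ^ (n + 1) ∣ a) : ¬ uniformizer R ^ (n + 1) ∣ ((a : ℤ) : R) := by
  rw [← redCoeff_eq_zero_iff (uniformizer_pow_dvd_intCast hpε h), redCoeff_intCast hpε h]
  exact mul_ne_zero (pow_ne_zero _ ((isUnit_iff_residue_ne_zero _).mp hε))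
    (residue_intCast_ne_zero hp hpε (not_dvd_div_of_pexact h h'))

/-- The residue of the unit `ε` is non-zero. [folklore] -/
theorem residue_ne_zero_of_isUnit (hε : IsUnit ε) : residue R ε ≠ 0 :=
  (isUnit_iff_residue_ne_zero _).mp hε

/-! ### The engine over a DVR: Steps 6–10 read on the cast of a normalised INTEGER model -/

omit [IsDomain R] [IsDiscreteValuationRing R] in
/-- Coefficients and discriminant of the cast of an integer model. [folklore] -/
theorem map_intCast_eqs (M : WeierstrassCurve ℤ) :
    (M.map (Int.castRingHom R)).a₁ = (M.a₁ : R) ∧ (M.map (Int.castRingHom R)).a₂ = (M.a₂ : R) ∧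
    (M.map (Int.castRingHom R)).a₃ = (M.a₃ : R) ∧ (M.map (Int.castRingHom R)).a₄ = (M.a₄ : R) ∧
    (M.map (Int.castRingHom R)).a₆ = (M.a₆ : R) ∧ (M.map (Int.castRingHom R)).Δ = (M.Δ : R) := by
  refine ⟨?_, ?_, ?_, ?_, ?_, ?_⟩ <;> simp [WeierstrassCurve.map_Δ]

/-- **Type `I₀*` read on an integer model** (Step 6): if `p ∣ a₁, a₂`, `p² ∣ a₃, a₄`, `p³ ∣ a₆`
and `p ∤ disc (T³ + (a₂/p) T² + (a₄/p²) T + a₆/p³)`, Tate's algorithm over any DVR `R` with perfect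
residue field in which `p = ϖ ε` returns `I₀*` on the cast model (the cubic of Step 6 is
`ε̄³ P(T/ε̄)`, `P` the reduction of the integer cubic, and has three distinct roots iff `P` has).
[cite: Silverman1994, IV.9.4 Step 6] -/
theorem kodairaSymbolOfMinimal_intCast_eq_Istar_zero [PerfectField (ResidueField R)] (hp : p.Prime)
    (hε : IsUnit ε) (hpε : (p : R) = uniformizer R * ε) {M : WeierstrassCurve ℤ}
    (h1 : (p : ℤ) ^ 1 ∣ M.a₁) (h2 : (p : ℤ) ^ 1 ∣ M.a₂) (h3 : (p : ℤ) ^ 2 ∣ M.a₃)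
    (h4 : (p : ℤ) ^ 2 ∣ M.a₄) (h6 : (p : ℤ) ^ 3 ∣ M.a₆)
    (hd : ¬ (p : ℤ) ^ 1 ∣ disc3 (M.a₂ / (p : ℤ) ^ 1) (M.a₄ / (p : ℤ) ^ 2) (M.a₆ / (p : ℤ) ^ 3)) :
    (M.map (Int.castRingHom R)).kodairaSymbolOfMinimal = .Istar 0 := by
  obtain ⟨e1, e2, e3, e4, e6, -⟩ := map_intCast_eqs (R := R) M
  have hē := residue_ne_zero_of_isUnit hε
  refine kodairaSymbolOfMinimal_eq_Istar_zero_of_step6 ?_ ?_ ?_ ?_ ?_ ?_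
  · rw [e1]; exact uniformizer_dvd_intCast hpε h1
  · rw [e2]; exact uniformizer_dvd_intCast hpε h2
  · rw [e3]; exact uniformizer_pow_dvd_intCast hpε h3
  · rw [e4]; exact uniformizer_pow_dvd_intCast hpε h4
  · rw [e6]; exact uniformizer_pow_dvd_intCast hpε h6
  · rw [cubicStep6, distinctRootCount_cubic_eq_three_iff, e2, e4, e6, redCoeff_intCast hpε h2,
      redCoeff_intCast hpε h4, redCoeff_intCast hpε h6]
    rw [pow_one] at hd
    have key : ∀ (e A B C : ResidueField R),
        (e ^ 1 * A) ^ 2 * (e ^ 2 * B) ^ 2 - 4 * (e ^ 2 * B) ^ 3 - 4 * (e ^ 1 * A) ^ 3 * (e ^ 3 * C)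
          - 27 * (e ^ 3 * C) ^ 2 + 18 * (e ^ 1 * A) * (e ^ 2 * B) * (e ^ 3 * C) =
        e ^ 6 * (A ^ 2 * B ^ 2 - 4 * B ^ 3 - 4 * A ^ 3 * C - 27 * C ^ 2 + 18 * A * B * C) := by
      intros; ring
    rw [key]
    refine mul_ne_zero (pow_ne_zero _ hē) ?_
    have := residue_intCast_ne_zero hp hpε hd
    simpa [disc3, map_ofNat] using this

/-- **Type `IV*` read on an integer model** (Step 8): if `p ∣ a₁`, `p² ∣ a₂, a₃`, `p³ ∣ a₄`,
`p⁴ ∣ a₆` and `p ∤ (a₃/p²)² + 4 (a₆/p⁴)`, Tate's algorithm returns `IV*` on the cast model (the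
quadratic of Step 8 is `Y² + ε̄² A₃ Y - ε̄⁴ A₆`, with distinct roots iff `A₃² + 4 A₆ ≢ 0`).
[cite: Silverman1994, IV.9.4 Step 8] -/
theorem kodairaSymbolOfMinimal_intCast_eq_IVstar [PerfectField (ResidueField R)] (hp : p.Prime)
    (hε : IsUnit ε) (hpε : (p : R) = uniformizer R * ε) {M : WeierstrassCurve ℤ}
    (h1 : (p : ℤ) ^ 1 ∣ M.a₁) (h2 : (p : ℤ) ^ 2 ∣ M.a₂) (h3 : (p : ℤ) ^ 2 ∣ M.a₃)
    (h4 : (p : ℤ) ^ 3 ∣ M.a₄) (h6 : (p : ℤ) ^ 4 ∣ M.a₆)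
    (hq : ¬ (p : ℤ) ^ 1 ∣ (M.a₃ / (p : ℤ) ^ 2) ^ 2 + 4 * (M.a₆ / (p : ℤ) ^ 4)) :
    (M.map (Int.castRingHom R)).kodairaSymbolOfMinimal = .IVstar := by
  obtain ⟨e1, e2, e3, e4, e6, -⟩ := map_intCast_eqs (R := R) M
  have hē := residue_ne_zero_of_isUnit hε
  refine kodairaSymbolOfMinimal_eq_IVstar_of_step8 ?_ ?_ ?_ ?_ ?_ ?_
  · rw [e1]; exact uniformizer_dvd_intCast hpε h1
  · rw [e2]; exact uniformizer_pow_dvd_intCast hpε h2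
  · rw [e3]; exact uniformizer_pow_dvd_intCast hpε h3
  · rw [e4]; exact uniformizer_pow_dvd_intCast hpε h4
  · rw [e6]; exact uniformizer_pow_dvd_intCast hpε h6
  · rw [quadraticStep8, TateAlgorithm.distinctRootCount_sq_add_sub_eq_two_iff, e3, e6, redCoeff_intCast hpε h3,
      redCoeff_intCast hpε h6]
    rw [pow_one] at hq
    have key : ∀ (e A C : ResidueField R),
        (e ^ 2 * A) ^ 2 + 4 * (e ^ 4 * C) = e ^ 4 * (A ^ 2 + 4 * C) := by intros; ring
    rw [key]
    refine mul_ne_zero (pow_ne_zero _ hē) ?_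
    have := residue_intCast_ne_zero hp hpε hq
    simpa [map_ofNat] using this

/-- **Type `III*` read on an integer model** (Step 9): if `p ∣ a₁`, `p² ∣ a₂`, `p³ ∣ a₃`,
`p³ ∥ a₄`, `p⁵ ∣ a₆`, Tate's algorithm returns `III*` on the cast model.
[cite: Silverman1994, IV.9.4 Step 9] -/
theorem kodairaSymbolOfMinimal_intCast_eq_IIIstar [PerfectField (ResidueField R)] (hp : p.Prime)
    (hε : IsUnit ε) (hpε : (p : R) = uniformizer R * ε) {M : WeierstrassCurve ℤ}
    (h1 : (p : ℤ) ^ 1 ∣ M.a₁) (h2 : (p : ℤ) ^ 2 ∣ M.a₂) (h3 : (p : ℤ) ^ 3 ∣ M.a₃)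
    (h4 : (p : ℤ) ^ 3 ∣ M.a₄) (h4' : ¬ (p : ℤ) ^ (3 + 1) ∣ M.a₄) (h6 : (p : ℤ) ^ 5 ∣ M.a₆) :
    (M.map (Int.castRingHom R)).kodairaSymbolOfMinimal = .IIIstar := by
  obtain ⟨e1, e2, e3, e4, e6, -⟩ := map_intCast_eqs (R := R) M
  refine kodairaSymbolOfMinimal_eq_IIIstar_of_step9 ?_ ?_ ?_ ?_ ?_ ?_
  · rw [e1]; exact uniformizer_dvd_intCast hpε h1
  · rw [e2]; exact uniformizer_pow_dvd_intCast hpε h2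
  · rw [e3]; exact uniformizer_pow_dvd_intCast hpε h3
  · rw [e4]; exact uniformizer_pow_dvd_intCast hpε h4
  · rw [e6]; exact uniformizer_pow_dvd_intCast hpε h6
  · rw [e4]; exact not_pow_succ_dvd_intCast hp hε hpε h4 h4'

/-- **Type `II*` read on an integer model** (Step 10): if `p ∣ a₁`, `p² ∣ a₂`, `p³ ∣ a₃`,
`p⁴ ∣ a₄`, `p⁵ ∥ a₆`, Tate's algorithm returns `II*` on the cast model.
[cite: Silverman1994, IV.9.4 Step 10] -/
theorem kodairaSymbolOfMinimal_intCast_eq_IIstar [PerfectField (ResidueField R)] (hp : p.Prime)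
    (hε : IsUnit ε) (hpε : (p : R) = uniformizer R * ε) {M : WeierstrassCurve ℤ}
    (h1 : (p : ℤ) ^ 1 ∣ M.a₁) (h2 : (p : ℤ) ^ 2 ∣ M.a₂) (h3 : (p : ℤ) ^ 3 ∣ M.a₃)
    (h4 : (p : ℤ) ^ 4 ∣ M.a₄) (h6 : (p : ℤ) ^ 5 ∣ M.a₆) (h6' : ¬ (p : ℤ) ^ (5 + 1) ∣ M.a₆) :
    (M.map (Int.castRingHom R)).kodairaSymbolOfMinimal = .IIstar := by
  obtain ⟨e1, e2, e3, e4, e6, -⟩ := map_intCast_eqs (R := R) M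
  refine kodairaSymbolOfMinimal_eq_IIstar_of_step9 ?_ ?_ ?_ ?_ ?_ ?_
  · rw [e1]; exact uniformizer_dvd_intCast hpε h1
  · rw [e2]; exact uniformizer_pow_dvd_intCast hpε h2
  · rw [e3]; exact uniformizer_pow_dvd_intCast hpε h3
  · rw [e4]; exact uniformizer_pow_dvd_intCast hpε h4
  · rw [e6]; exact uniformizer_pow_dvd_intCast hpε h6
  · rw [e6]; exact not_pow_succ_dvd_intCast hp hε hpε h6 h6'

end DVR

end Summit.BirchSwinnertonDyer.BirchSwinnertonDyer.Rank2Observatory.Tate
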